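import Summits.ResolutionOfSingularities.ResolutionOfSingularities.Theorems.MarkingBudgetClasses
import HarnessLib

/-!
# MarkingBudgetKernels — §11 of the decomp-res node «MarkingBudget» (lens-4 g15; CRITIC-LEDGER row 101 CLEARED)

Content VERBATIM from the decomp-res lens-4 cumulative file `HOME/decomp-res-lens-4/g18/CouplingCut.lean` (sha256
5bf7b2ca8f7311e8;
its §1–§6 = g14 HugValuationCut, ALREADY in the tree as `Theorems/HugValuationCut{Chains,Classes,Kernels}` +
`MaxContactCutHugValuationCut`; §7–§12 = g15 «MarkingBudget» @369c12ac; §13–§17 = g16 «WeightDescent»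
@1cb1c32f; §18–§23 = g17
«FactorContact» @daf245ab; §24–§31 = g18 «CouplingCut»).  HOME = run/shared/lean/pub/decomp-res.

Tree file 2/3, route-independent, cone-free: §10 the marking port (COSTUME) + `markingPort_zero`; §11 the KERNELS
(PROVED) — (O-arc) THE OFF-LOCUS ARC CELL IS EMPTY for all `k`, `p`, `d ≤ 4`,
PORT-FREE (`offLocusArc_terminate`, all weights `noOffLocusArcTowers`), the exact bisection of the in-locus column
by g14's value grid
(`inLocus_iff_grid`), the joint exactness of the g14 × g15 grids, and the routing of g14's off-locus (D-imp) into
the decided cell;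
§12 the all-weights classes `NoOffLocusArcTowers` [DECIDED: `noOffLocusArcTowers`], `NoOffLocusShadowTowers` [(O)
located residual ·
UNDECIDED · INSTRUMENTABLE I-T], `NoInLocusShadowTowers` [(L)], `NoInLocusDiscreteImperfectShadowTowers` [(L,D-imp) · BARRIER
SmoothVsRegularImperfectBase], `NoInLocusDenseShadowTowers` [(L,Z)], `MarkingPortAll` (aside statements of the host route).
[WRITER NOTE (decomp-res writer g6): the whole lens-4 chain lives in ONE namespace `…Theorems.HugValuationCut` (the tree's g14
namespace) so that the lens's `HugChain.`/`HugShadow.`/`MarkedShadow.` dot-notation extends the landed structures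
verbatim; the lens's
`noTower_iff_perfect_and_imperfect` is the tree's `ContactShadowKernels.noTower_iff_columns`; `set_option` lines
dropped; cone-free
(no `Theses` import) so the route file can import it for asides; the BY-NAME wiring to the MaxContactCut items is in the
`MaxContactCut<Node>` companion files.]
(Sources: CossartJannsenSaito2020 Thm. 2.14, Key Thm. 6.40, Cor. 6.37; BierstoneGrigorievMilmanWlodarczyk2011 §3;
CossartPiltant2019; Abhyankar1956; Cutkosky2009 §2.1.)
-/

noncomputable section

open CategoryTheory AlgebraicGeometry IsLocalRing
open Literature.AlgebraicGeometry.Resolution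
open Summit.ResolutionOfSingularities.ResolutionOfSingularities.Theorems
open WeakOrderReduction ForcedTowerClasses DivergentTowerClasses MonomialTowerClasses
open HugDimensionClasses HugDimensionKernels SurfaceShadowClasses SurfaceShadowKernels
open ContactShadowClasses (NoTowerImperfect)
open ContactShadowKernels (noTowerImperfect_of_noTower noTowerImperfect_mono noTower_iff_columns)
open NearPointCut (SingularClass singularSurface_iff_noTower)

namespace Summit.ResolutionOfSingularities.ResolutionOfSingularities.Theorems.HugValuationCut

variable {K : Type} [Field K]

/-! ## §10 (g15 · NEW) The marking port (COSTUME, counted 0; paper proof (P4) in the module docstring) -/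

/-- **PORT `MarkingPort` — COSTUME** (paper proof (P4): on the GEOMETRIC shadow chain of the hugged surface
`V(germ)` — g14 (P1)(b), pins compatible with the transition maps — restrict a non-zero element of `I_m|Σ` and take
controlled transforms; the exceptional equations are dividers).  Every tower of the class with an OFF-LOCUS shadow
admits a MARKED shadow of weight `n`. -/
def MarkingPort (n : ℕ) : Prop :=
  ∀ p : ℕ, p.Prime → ∀ (k : Type) [Field k] [CharP k p] (T : ForcedTower) (g : T.St 0 ⟶ Spec (.of k)),
    IsBase (T.St 0) g → IsDatum n (T.D 0) → (T.D 0).boundary = [] → ∀ S : HugShadow T, S.OffLocus →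
      Nonempty (MarkedShadow T n)

/-- **THE PORT IS THE WEIGHT (PROVED, port-free sanity anchor)**: at weight `0` every off-locus shadow is trivially
marked (`f ≡ 1` over any divider sequence) — the content of `MarkingPort n`, and of the budget law, is exactly
`n ≥ 1`. [folklore] -/
theorem markingPort_zero : MarkingPort 0 := by
  intro _ _ _ _ _ T _ _ _ _ S hS
  obtain ⟨z, hz⟩ := S.C.exists_isDividerSeq
  exact ⟨⟨S, hS, z, fun _ => 1, hz, ⟨fun i => ⟨(S.C.R i).one_mem, one_ne_zero⟩, fun i => by simp⟩⟩⟩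

/-! ## §11 (g15 · NEW) Kernels (PROVED) -/

/-- **KERNEL — (O-arc) THE OFF-LOCUS ARC CELL IS EMPTY for ALL `k`, `p`, `d ≤ 4`, PORT-FREE** (the PROVED budget law
`HugChain.not_isZValued_of_marked`; no Jacobian, no perfectness, no port). [folklore] -/
theorem offLocusArc_terminate {n : ℕ} (hn : 1 ≤ n) : OffLocusArcTowersTerminate n :=
  fun _ _ _ _ _ _ _ _ _ _ hT => not_offLocusArc hn hT.2

/-- Necessity, PORT-FREE: the target implies every g15 piece and cell (sub-classes). [folklore] -/
theorem pieces_of_singularSurface_g15 {n : ℕ} (h : SingularSurfaceHuggingTowersTerminate n) :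
    OffLocusArcTowersTerminate n ∧ OffLocusShadowTowersTerminate n ∧ GeometricOffLocusTowersTerminate n ∧
      InLocusShadowTowersTerminate n ∧ InLocusDiscretePerfectShadowTowersTerminate n ∧
        InLocusDiscreteImperfectShadowTowersTerminate n ∧ InLocusDenseShadowTowersTerminate n := by
  have hLD : NoTower n (fun T => SingularClass T ∧ InLocusShadow T ∧ DiscreteShadow T) :=
    noTower_mono (fun _ h' => h'.1) h
  exact ⟨noTower_mono (fun _ h' => h'.1) h, noTower_mono (fun _ h' => h'.1) h, noTower_mono (fun _ h' => h'.1) h,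
    noTower_mono (fun _ h' => h'.1) h, ((noTower_iff_columns _).mp hLD).1,
    ((noTower_iff_columns _).mp hLD).2, noTower_mono (fun _ h' => h'.1) h⟩

/-- **KERNEL — THE EXACT LOCUS CUT of the singular-surface leaf 32260** (modulo the two COSTUME ports, ENGINE-FREE):
`SingularSurfaceHuggingTowersTerminate n ⟺ (O) ∧ (L)` — excluded middle on «some shadow is off-locus»; the off-locus
arcs inside (O) are impossible outright (`not_offLocusArc`). [folklore] -/
theorem singularSurface_iff_pieces_g15 {n : ℕ} (hP : ShadowPort n) (hM : MarkingPort n) :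
    SingularSurfaceHuggingTowersTerminate n ↔
      OffLocusShadowTowersTerminate n ∧ InLocusShadowTowersTerminate n := by
  refine ⟨fun h => ⟨(pieces_of_singularSurface_g15 h).2.1, (pieces_of_singularSurface_g15 h).2.2.2.1⟩, ?_⟩
  rintro ⟨h₁, h₂⟩ p hp k _ _ T g hB hDat hE hS
  obtain ⟨S⟩ := hP p hp k T g hB hDat hE hS.2.1 hS.2.2.1
  by_cases hO : OffLocusShadow T
  · obtain ⟨S₁, hS₁⟩ := hO
    obtain ⟨M⟩ := hM p hp k T g hB hDat hE S₁ hS₁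
    exact h₁ p hp k T g hB hDat hE ⟨hS, ⟨M⟩⟩
  · exact h₂ p hp k T g hB hDat hE ⟨hS, ⟨S⟩, not_offLocusShadow_iff.mp hO⟩

/-- (O) on the datum ⟺ (O) on the pinned predicate, modulo the marking port. [folklore] -/
theorem offLocus_iff_marked {n : ℕ} (hM : MarkingPort n) :
    OffLocusShadowTowersTerminate n ↔ GeometricOffLocusTowersTerminate n := by
  refine ⟨fun h p hp k _ _ T g hB hDat hE hT => ?_,
    fun h => noTower_mono (fun T h' => ⟨h'.1, h'.2.elim fun M => offLocusShadow_of_marked M⟩) h⟩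
  obtain ⟨S₁, hS₁⟩ := hT.2
  obtain ⟨M⟩ := hM p hp k T g hB hDat hE S₁ hS₁
  exact h p hp k T g hB hDat hE ⟨hT.1, ⟨M⟩⟩

/-- **KERNEL — the in-locus column is bisected EXACTLY by g14's valuation type × perfectness** (pure logic).
[folklore] -/
theorem inLocus_iff_grid {n : ℕ} :
    InLocusShadowTowersTerminate n ↔ InLocusDiscretePerfectShadowTowersTerminate n ∧
      InLocusDiscreteImperfectShadowTowersTerminate n ∧ InLocusDenseShadowTowersTerminate n := by
  constructor
  · intro h
    have hD : NoTower n (fun T => SingularClass T ∧ InLocusShadow T ∧ DiscreteShadow T) :=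
      noTower_mono (fun _ h' => ⟨h'.1, h'.2.1⟩) h
    exact ⟨((noTower_iff_columns _).mp hD).1, ((noTower_iff_columns _).mp hD).2,
      noTower_mono (fun _ h' => ⟨h'.1, h'.2.1⟩) h⟩
  · rintro ⟨h₁, h₂, h₃⟩
    have hD : NoTower n (fun T => SingularClass T ∧ InLocusShadow T ∧ DiscreteShadow T) :=
      (noTower_iff_columns _).mpr ⟨h₁, h₂⟩
    intro p hp k _ _ T g hB hDat hE hT
    by_cases hd : DiscreteShadow T
    · exact hD p hp k T g hB hDat hE ⟨hT.1, hT.2, hd⟩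
    · exact h₃ p hp k T g hB hDat hE ⟨hT.1, hT.2, hd⟩

/-- **CELL (L, D-perf) is DECIDED by g14's engine** (inherited). [folklore] -/
theorem inLocusDiscretePerfect_of_law {n : ℕ} (hL : DiscreteShadowLaw n) :
    InLocusDiscretePerfectShadowTowersTerminate n :=
  noTowerPerfect_mono (fun _ h => ⟨h.1, h.2.2⟩) (discretePerfect_of_law hL)

/-- **KERNEL — THE TARGET LEAF FROM THE TWO g15 RESIDUALS (O), (L)** modulo the two COSTUME ports (engine-free).
[folklore] -/
theorem singularSurface_of_g15 {n : ℕ} (hP : ShadowPort n) (hM : MarkingPort n)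
    (hO : OffLocusShadowTowersTerminate n) (hL : InLocusShadowTowersTerminate n) :
    SingularSurfaceHuggingTowersTerminate n :=
  (singularSurface_iff_pieces_g15 hP hM).2 ⟨hO, hL⟩

/-- **KERNEL — THE TARGET LEAF FROM THE THREE RESIDUAL CELLS (O), (L, D-imp), (L, Z)** modulo the two COSTUME ports
and g14's engine. [folklore] -/
theorem singularSurface_of_grid {n : ℕ} (hP : ShadowPort n) (hM : MarkingPort n) (hLaw : DiscreteShadowLaw n)
    (hO : OffLocusShadowTowersTerminate n) (hI : InLocusDiscreteImperfectShadowTowersTerminate n)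
    (hZ : InLocusDenseShadowTowersTerminate n) : SingularSurfaceHuggingTowersTerminate n :=
  singularSurface_of_g15 hP hM hO (inLocus_iff_grid.2 ⟨inLocusDiscretePerfect_of_law hLaw, hI, hZ⟩)

/-- **EXACT at the grid**: modulo the ports and the engine, `32260 at n ⟺ (O) ∧ (L, D-imp) ∧ (L, Z)`. [folklore] -/
theorem singularSurface_iff_grid {n : ℕ} (hP : ShadowPort n) (hM : MarkingPort n) (hLaw : DiscreteShadowLaw n) :
    SingularSurfaceHuggingTowersTerminate n ↔ OffLocusShadowTowersTerminate n ∧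
      InLocusDiscreteImperfectShadowTowersTerminate n ∧ InLocusDenseShadowTowersTerminate n :=
  ⟨fun h => ⟨(pieces_of_singularSurface_g15 h).2.1, (pieces_of_singularSurface_g15 h).2.2.2.2.2.1,
    (pieces_of_singularSurface_g15 h).2.2.2.2.2.2⟩, fun h => singularSurface_of_grid hP hM hLaw h.1 h.2.1 h.2.2⟩

/-- Over PERFECT ground fields the leaf is `(O) ∧ (L, Z)` (modulo ports + engine). [folklore] -/
theorem singularSurfacePerfect_of_g15 {n : ℕ} (hP : ShadowPort n) (hM : MarkingPort n) (hLaw : DiscreteShadowLaw n)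
    (hO : OffLocusShadowTowersTerminate n) (hZ : InLocusDenseShadowTowersTerminate n) :
    NoTowerPerfect n SingularClass := by
  intro p hp k _ _ _ T g hB hDat hE hS
  obtain ⟨S⟩ := hP p hp k T g hB hDat hE hS.2.1 hS.2.2.1
  by_cases hOf : OffLocusShadow T
  · obtain ⟨S₁, hS₁⟩ := hOf
    obtain ⟨M⟩ := hM p hp k T g hB hDat hE S₁ hS₁
    exact hO p hp k T g hB hDat hE ⟨hS, ⟨M⟩⟩
  · have hL : InLocusShadow T := ⟨⟨S⟩, not_offLocusShadow_iff.mp hOf⟩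
    by_cases hd : DiscreteShadow T
    · exact discretePerfect_of_law hLaw p hp k T g hB hDat hE ⟨hS, hd⟩
    · exact hZ p hp k T g hB hDat hE ⟨hS, hL, hd⟩

/-! ### The two grids are JOINTLY exact: g14's pieces from g15's and back (by name) -/

/-- g14's residual (Z) SPLITS along the locus axis (modulo the marking port): its off-locus half lies in (O), its
in-locus half is the cell (L, Z). [folklore] -/
theorem denseShadow_of_g15 {n : ℕ} (hM : MarkingPort n) (hO : OffLocusShadowTowersTerminate n)
    (hZ : InLocusDenseShadowTowersTerminate n) : DenseShadowTowersTerminate n := by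
  intro p hp k _ _ T g hB hDat hE hT
  obtain ⟨hS, hne, hnd⟩ := hT
  by_cases hOf : OffLocusShadow T
  · obtain ⟨S₁, hS₁⟩ := hOf
    obtain ⟨M⟩ := hM p hp k T g hB hDat hE S₁ hS₁
    exact hO p hp k T g hB hDat hE ⟨hS, ⟨M⟩⟩
  · exact hZ p hp k T g hB hDat hE ⟨hS, ⟨hne, not_offLocusShadow_iff.mp hOf⟩, hnd⟩

/-- the cell (L, Z) is a sub-class of g14's (Z). [folklore] -/
theorem inLocusDense_of_denseShadow {n : ℕ} (hZ : DenseShadowTowersTerminate n) :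
    InLocusDenseShadowTowersTerminate n :=
  noTower_mono (fun _ h => ⟨h.1, h.2.1.1, h.2.2⟩) hZ

/-- g14's residual (D-imp) REDUCES, modulo the marking port, to the in-locus cell (L, D-imp) and the off-locus
residual (O) (which absorbs the mixed towers: an in-locus arc next to an off-locus shadow). [folklore] -/
theorem discreteImperfect_of_g15 {n : ℕ} (hM : MarkingPort n) (hO : OffLocusShadowTowersTerminate n)
    (hI : InLocusDiscreteImperfectShadowTowersTerminate n) : DiscreteImperfectShadowTowersTerminate n := by
  intro p hp k _ _ hk T g hB hDat hE hT
  obtain ⟨hS, hd⟩ := hT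
  by_cases hOf : OffLocusShadow T
  · obtain ⟨S₁, hS₁⟩ := hOf
    obtain ⟨M⟩ := hM p hp k T g hB hDat hE S₁ hS₁
    exact hO p hp k T g hB hDat hE ⟨hS, ⟨M⟩⟩
  · have hne : Nonempty (HugShadow T) := by
      obtain ⟨S, -⟩ := hd
      exact ⟨S⟩
    exact hI p hp k hk T g hB hDat hE ⟨hS, ⟨hne, not_offLocusShadow_iff.mp hOf⟩, hd⟩

/-- the cell (L, D-imp) is a sub-class of g14's (D-imp). [folklore] -/
theorem inLocusDiscreteImperfect_of_discreteImperfect {n : ℕ} (hI : DiscreteImperfectShadowTowersTerminate n) :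
    InLocusDiscreteImperfectShadowTowersTerminate n :=
  noTowerImperfect_mono (fun _ h => ⟨h.1, h.2.2⟩) hI

/-- the off-locus residual (O) is a sub-class of g14's (D) ∧ (Z) (so of the target), PORT-FREE: compatibility of
the two cuts. [folklore] -/
theorem offLocus_of_g14 {n : ℕ} (hD : DiscreteShadowTowersTerminate n) (hZ : DenseShadowTowersTerminate n) :
    OffLocusShadowTowersTerminate n := by
  intro p hp k _ _ T g hB hDat hE hT
  obtain ⟨hS, ⟨M⟩⟩ := hT
  by_cases hd : DiscreteShadow T
  · exact hD p hp k T g hB hDat hE ⟨hS, hd⟩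
  · exact hZ p hp k T g hB hDat hE ⟨hS, ⟨M.S⟩, hd⟩

/-- **JOINT EXACTNESS of the g14 × g15 grid** (modulo the marking port and the decided g14 cell (D-perf)): g14's two
residuals `(D-imp) ∧ (Z)` ⟺ g15's three residual cells `(O) ∧ (L, D-imp) ∧ (L, Z)`. [folklore] -/
theorem g14_residuals_iff_grid {n : ℕ} (hM : MarkingPort n) (hDP : DiscretePerfectShadowTowersTerminate n) :
    DiscreteImperfectShadowTowersTerminate n ∧ DenseShadowTowersTerminate n ↔
      OffLocusShadowTowersTerminate n ∧ InLocusDiscreteImperfectShadowTowersTerminate n ∧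
        InLocusDenseShadowTowersTerminate n :=
  ⟨fun h => ⟨offLocus_of_g14 ((noTower_iff_columns _).mpr ⟨hDP, h.1⟩) h.2,
    inLocusDiscreteImperfect_of_discreteImperfect h.1, inLocusDense_of_denseShadow h.2⟩,
    fun h => ⟨discreteImperfect_of_g15 hM h.1 h.2.1, denseShadow_of_g15 hM h.1 h.2.2⟩⟩

/-! ## §12 (g15) The all-weights classes and the port-free all-weights kernel (the BY-NAME wiring theorems are in
`MaxContactCutMarkingBudget`) -/

/-- The decided cell over all markings (a THEOREM: `noOffLocusArcTowers`). -/
def NoOffLocusArcTowers : Prop := ∀ n : ℕ, 1 ≤ n → OffLocusArcTowersTerminate n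

/-- The g15 residual (O) over all markings: «no singular-class tower with a marked (= off-locus) shadow». -/
def NoOffLocusShadowTowers : Prop := ∀ n : ℕ, 1 ≤ n → OffLocusShadowTowersTerminate n

/-- The g15 residual column (L) over all markings: «no singular-class tower all of whose shadows are in-locus». -/
def NoInLocusShadowTowers : Prop := ∀ n : ℕ, 1 ≤ n → InLocusShadowTowersTerminate n

/-- The cell (L, D-imp) over all markings. -/
def NoInLocusDiscreteImperfectShadowTowers : Prop :=
  ∀ n : ℕ, 1 ≤ n → InLocusDiscreteImperfectShadowTowersTerminate n

/-- The cell (L, Z) over all markings. -/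
def NoInLocusDenseShadowTowers : Prop := ∀ n : ℕ, 1 ≤ n → InLocusDenseShadowTowersTerminate n

/-- The marking port over all markings. -/
def MarkingPortAll : Prop := ∀ n : ℕ, 1 ≤ n → MarkingPort n

/-- **THE DECIDED CELL, all markings — a THEOREM (no port, no engine).** [folklore] -/
theorem noOffLocusArcTowers : NoOffLocusArcTowers := fun _ hn => offLocusArc_terminate hn

end Summit.ResolutionOfSingularities.ResolutionOfSingularities.Theorems.HugValuationCut
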